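import Literature.Analysis.Matrix.FiniteRangeDecompositionPowSymbol
import HarnessLib

/-!
# Finite-range decomposition with smoother pieces, III: Fourier LOWER bounds on the momentum cube

For a translation-invariant symmetric matrix `A` on a finite abelian group `G` with `0 ≤ A ≤ 4`
(Loewner), the power-`m` pieces `C^{(m)}_N = frdPiecePow A m N` and remainders
`R^{(m)}_J = frdRemainderPow A m J` of `FiniteRangeDecompositionPow.lean` have the real nonnegative
symbols `σ_{C^{(m)}_N}(ψ) = ¼ · 4^N ρ_N(x)^{m+1} Σ_{i<m} c_N(x)^i` and `σ_{R^{(m)}_J}(ψ) = ρ_J(x)^m`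
(`a = σ_A(ψ) = 4 sin²(πx)`, `x = frdAngle a ∈ [0, ½]`, `ρ_N(x) = F_{2^N−1}(x)/2^N = Π_{i<N} cos²(π2^i x)`,
`c_N(x) = cos²(π 2^N x)`; `FiniteRangeDecompositionPowSymbol.lean`).  Part II gave UPPER bounds; here
we add the complementary LOWER bounds ON THE MOMENTUM CUBE `|x| ≤ 2^{−(N+1)}`, i.e. below the shell
of the piece:

* `fejer_two_pow_div_ge`      : `ρ_N(x) ≥ 4/π²` for `|x| ≤ 2^{−(N+1)}` (the peak of the Fejér kernel,
                                `FejerJacksonKernels.fejer_ge_peak`, with `M + 1 = 2^N`);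
* `frdAngle_le_sqrt_div_four` : Jordan's inequality `x(a) ≤ √a/4`, whence
  `frdAngle_le_of_le`         : `a ≤ 4/4^N ⇒ x(a) ≤ 2^{−(N+1)}`;
* `symbol_frdRemainderPow_re_ge` : `(4/π²)^m ≤ σ_{R^{(m)}_J}(ψ)` whenever `σ_A(ψ) ≤ 4/4^J`;
* `symbol_frdPiecePow_re_ge`     : `4^N (4/π²)^{m+1}/4 ≤ σ_{C^{(m)}_N}(ψ)` whenever `σ_A(ψ) ≤ 4/4^N`
                                   and `m ≥ 1`.

These are the dyadic counterparts of the Fourier LOWER bounds (A.28)/(A.29) in the proof of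
Theorem 2.3 of Buchholz (the remainder/last block: `𝒞̂_k(p) ≥ ε L^{2k}/(16R²)` for `|p| ≤ L^{−k}`;
the UV pieces: `≥ (ε/2) min(|p|⁻², …)`), which feed the global lower bounds of his Proposition 3.1 /
Theorem 2.4 (= Adams–Buchholz–Kotecký–Müller, arXiv:1910.13564, Thm 6.1).
[cite: Buchholz2016, App. A, (A.28)–(A.29) (form of the bounds)]; all statements [folklore].
-/

noncomputable section

open Finset Real
open Literature.Analysis.Fourier Literature.Analysis.Fourier.TrigApprox

namespace Literature.Analysis.Matrix

/-! ## The peak of the dyadic Fejér ratio -/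

/-- `((2^N − 1 : ℕ) : ℝ) + 1 = 2^N`. [folklore] -/
private theorem cast_two_pow_sub_one_add_one' (N : ℕ) : ((2 ^ N - 1 : ℕ) : ℝ) + 1 = 2 ^ N := by
  rw [Nat.cast_sub Nat.one_le_two_pow]; push_cast; ring

/-- **Peak of the dyadic ratio**: `ρ_N(x) = F_{2^N−1}(x)/2^N ≥ 4/π²` for `|x| ≤ 2^{−(N+1)}`
(the momentum cube below the `N`-th shell) — the dyadic form of the lower bound `W_t(λ) ≥ ε` for
`λ ≤ B min(1, t⁻²)` of the scale functions. [cite: Buchholz2016, Lemma 5.1, (A.4) (dyadic form)] -/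
theorem fejer_two_pow_div_ge (N : ℕ) {x : ℝ} (hx : |x| ≤ 1 / (2 * 2 ^ N)) :
    4 / π ^ 2 ≤ fejer (2 ^ N - 1) x / 2 ^ N := by
  have h2N : (0 : ℝ) < 2 ^ N := by positivity
  have hx' : |x| ≤ 1 / (2 * (((2 ^ N - 1 : ℕ) : ℝ) + 1)) := by
    rwa [cast_two_pow_sub_one_add_one']
  have h := fejer_ge_peak (2 ^ N - 1) hx'
  rw [cast_two_pow_sub_one_add_one'] at h
  rw [le_div_iff₀ h2N]
  calc 4 / π ^ 2 * 2 ^ N = 4 * 2 ^ N / π ^ 2 := by ring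
    _ ≤ fejer (2 ^ N - 1) x := h

/-- `ρ_N(x)^m ≥ (4/π²)^m` on the momentum cube `|x| ≤ 2^{−(N+1)}`.
[cite: Buchholz2016, Lemma 5.1, (A.4) (dyadic form, power `m`)] -/
theorem fejer_two_pow_div_pow_ge (m N : ℕ) {x : ℝ} (hx : |x| ≤ 1 / (2 * 2 ^ N)) :
    (4 / π ^ 2) ^ m ≤ (fejer (2 ^ N - 1) x / 2 ^ N) ^ m :=
  pow_le_pow_left₀ (by positivity) (fejer_two_pow_div_ge N hx) m

/-- **Lower bound for the power-`m` piece function** on the momentum cube: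
`4^N (4/π²)^{m+1} ≤ W^{(m)}_N(x) = 4^N ρ_N^{m+1} Σ_{i<m} c_N^i` for `|x| ≤ 2^{−(N+1)}` and `m ≥ 1`
(keep the `i = 0` term of the sum). [cite: Buchholz2016, Lemma 5.1, (A.4) (dyadic form, for the piece function)] -/
theorem fejer_dyadic_piece_pow_ge {m : ℕ} (hm : 1 ≤ m) (N : ℕ) {x : ℝ} (hx : |x| ≤ 1 / (2 * 2 ^ N)) :
    4 ^ N * (4 / π ^ 2) ^ (m + 1)
      ≤ 4 ^ N * (fejer (2 ^ N - 1) x / 2 ^ N) ^ (m + 1)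
          * ∑ i ∈ Finset.range m, (Real.cos (π * (2 ^ N * x)) ^ 2) ^ i := by
  have hρ := fejer_two_pow_div_pow_ge (m + 1) N hx
  have hρ0 : 0 ≤ (fejer (2 ^ N - 1) x / 2 ^ N) ^ (m + 1) :=
    pow_nonneg (fejer_two_pow_div_nonneg N x) _
  -- the sum is at least its `i = 0` term, which is `1`
  have hS : (1 : ℝ) ≤ ∑ i ∈ Finset.range m, (Real.cos (π * (2 ^ N * x)) ^ 2) ^ i := by
    have h0m : 0 ∈ Finset.range m := Finset.mem_range.mpr hm
    have := Finset.single_le_sum (f := fun i => (Real.cos (π * (2 ^ N * x)) ^ 2) ^ i)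
      (fun i _ => by positivity) h0m
    simpa using this
  calc 4 ^ N * (4 / π ^ 2) ^ (m + 1)
      = 4 ^ N * (4 / π ^ 2) ^ (m + 1) * 1 := by ring
    _ ≤ 4 ^ N * (fejer (2 ^ N - 1) x / 2 ^ N) ^ (m + 1)
          * ∑ i ∈ Finset.range m, (Real.cos (π * (2 ^ N * x)) ^ 2) ^ i := by
        gcongr

/-! ## From the symbol of `A` to the momentum cube -/

/-- **Jordan's inequality for the angle variable**: `x(a) ≤ √a/4` for `0 ≤ a ≤ 4`
(from `sin(πx) = √a/2` and `sin t ≥ (2/π) t` on `[0, π/2]`) — in momentum language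
`(4/π²)|p|² ≤ |q(p)|² = |e^{ip} − 1|²`, `p = 2πx`, `a = |q|²`.
[cite: Buchholz2016, Sec. 2, the estimate after (2.21)] -/
theorem frdAngle_le_sqrt_div_four {a : ℝ} (ha0 : 0 ≤ a) (ha4 : a ≤ 4) :
    frdAngle a ≤ Real.sqrt a / 4 := by
  have hx0 : 0 ≤ frdAngle a := frdAngle_nonneg a
  have hxh : frdAngle a ≤ 1 / 2 := frdAngle_le_half a
  have hsin : 4 * Real.sin (π * frdAngle a) ^ 2 = a := four_mul_sin_sq_frdAngle ha0 ha4
  -- `sin(π x) ≥ 2x`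
  have hj : 2 / π * (π * frdAngle a) ≤ Real.sin (π * frdAngle a) :=
    Real.mul_le_sin (by positivity) (by nlinarith [Real.pi_pos])
  have hj' : 2 * frdAngle a ≤ Real.sin (π * frdAngle a) := by
    have : 2 / π * (π * frdAngle a) = 2 * frdAngle a := by field_simp
    linarith [this ▸ hj]
  have hs0 : 0 ≤ Real.sin (π * frdAngle a) := by linarith
  -- `sin(π x) = √a / 2`
  have hsq : Real.sin (π * frdAngle a) = Real.sqrt a / 2 := by
    have h1 : Real.sin (π * frdAngle a) ^ 2 = (Real.sqrt a / 2) ^ 2 := by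
      rw [div_pow, Real.sq_sqrt ha0]; linarith
    have h2 : 0 ≤ Real.sqrt a / 2 := by positivity
    nlinarith [sq_nonneg (Real.sin (π * frdAngle a) - Real.sqrt a / 2),
      sq_nonneg (Real.sin (π * frdAngle a) + Real.sqrt a / 2)]
  linarith [hsq ▸ hj']

/-- If `σ_A(ψ) = a ≤ 4/4^N` (and `0 ≤ a ≤ 4`) then the angle lies in the momentum cube:
`x(a) ≤ 2^{−(N+1)}` (corollary of the Jordan comparison `(4/π²)|p|² ≤ |q(p)|²`).
[cite: Buchholz2016, Sec. 2, the estimate after (2.21)] -/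
theorem frdAngle_le_of_le {a : ℝ} (ha0 : 0 ≤ a) (ha4 : a ≤ 4) (N : ℕ) (hN : a ≤ 4 / 4 ^ N) :
    |frdAngle a| ≤ 1 / (2 * 2 ^ N) := by
  rw [abs_of_nonneg (frdAngle_nonneg a)]
  have h2N : (0 : ℝ) < 2 ^ N := by positivity
  have hsqrt : Real.sqrt a ≤ 2 / 2 ^ N := by
    have h4 : (4 : ℝ) / 4 ^ N = (2 / 2 ^ N) ^ 2 := by
      rw [div_pow, ← pow_mul, show (2 : ℝ) ^ (N * 2) = 4 ^ N by rw [mul_comm, pow_mul]; norm_num]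
      norm_num
    calc Real.sqrt a ≤ Real.sqrt (4 / 4 ^ N) := Real.sqrt_le_sqrt hN
      _ = 2 / 2 ^ N := by rw [h4, Real.sqrt_sq (by positivity)]
  calc frdAngle a ≤ Real.sqrt a / 4 := frdAngle_le_sqrt_div_four ha0 ha4
    _ ≤ (2 / 2 ^ N) / 4 := by gcongr
    _ = 1 / (2 * 2 ^ N) := by field_simp; ring

/-! ## Lower bounds on the symbols -/

section Bounds

variable {G : Type*} [AddCommGroup G] [Fintype G] [DecidableEq G]
variable {A : _root_.Matrix G G ℝ} (ψ : AddChar G ℂ)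

/-- **Lower bound for the remainder on the momentum cube**: if `σ_A(ψ) ≤ 4/4^J` then
`(4/π²)^m ≤ σ_{R^{(m)}_J}(ψ)` — the dyadic form of Buchholz's (A.28)
(`𝒞̂_k(p) ≥ ε L^{2k}/(16R²)` for `|p| ≤ L^{−k}`, last block).
[cite: Buchholz2016, App. A, (A.28) (form of the bound)] -/
theorem symbol_frdRemainderPow_re_ge (hA : IsTranslationInvariant A) (hs : A.IsHermitian)
    (h0 : A.PosSemidef) (h4 : ((4 : ℝ) • (1 : _root_.Matrix G G ℝ) - A).PosSemidef)
    (m J : ℕ) (hle : (symbol A ψ).re ≤ 4 / 4 ^ J) :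
    (4 / π ^ 2) ^ m ≤ (symbol (frdRemainderPow A m J) ψ).re := by
  have hmem := symbol_re_mem_Icc ψ hA h0 h4
  rw [symbol_frdRemainderPow ψ hA hs h0 h4 m J, Complex.ofReal_re]
  exact fejer_two_pow_div_pow_ge m J (frdAngle_le_of_le hmem.1 hmem.2 J hle)

/-- **Lower bound for the power-`m` piece on the momentum cube**: if `σ_A(ψ) ≤ 4/4^N` and `m ≥ 1`
then `4^N (4/π²)^{m+1}/4 ≤ σ_{C^{(m)}_N}(ψ)` — the piece is of size `≍ 4^N` on and below its shell
(dyadic form of Buchholz's (A.28)/(A.29)). [cite: Buchholz2016, App. A, (A.28)–(A.29) (form of the bound)] -/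
theorem symbol_frdPiecePow_re_ge (hA : IsTranslationInvariant A) (hs : A.IsHermitian)
    (h0 : A.PosSemidef) (h4 : ((4 : ℝ) • (1 : _root_.Matrix G G ℝ) - A).PosSemidef)
    {m : ℕ} (hm : 1 ≤ m) (N : ℕ) (hle : (symbol A ψ).re ≤ 4 / 4 ^ N) :
    4 ^ N * (4 / π ^ 2) ^ (m + 1) / 4 ≤ (symbol (frdPiecePow A m N) ψ).re := by
  have hmem := symbol_re_mem_Icc ψ hA h0 h4
  rw [symbol_frdPiecePow ψ hA hs h0 h4 m N, Complex.ofReal_re]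
  have h := fejer_dyadic_piece_pow_ge hm N (frdAngle_le_of_le hmem.1 hmem.2 N hle)
  linarith

/-- The two-sided shell estimate packaged: on the momentum cube `σ_A(ψ) ≤ 4/4^N` (`m ≥ 1`),
`4^N (4/π²)^{m+1}/4 ≤ σ_{C^{(m)}_N}(ψ) ≤ m 4^N/4`.
[cite: Buchholz2016, App. A, (A.28)–(A.29) with (A.14) (form of the two-sided bound)] -/
theorem symbol_frdPiecePow_re_mem_Icc (hA : IsTranslationInvariant A) (hs : A.IsHermitian)
    (h0 : A.PosSemidef) (h4 : ((4 : ℝ) • (1 : _root_.Matrix G G ℝ) - A).PosSemidef)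
    {m : ℕ} (hm : 1 ≤ m) (N : ℕ) (hle : (symbol A ψ).re ≤ 4 / 4 ^ N) :
    (symbol (frdPiecePow A m N) ψ).re ∈ Set.Icc (4 ^ N * (4 / π ^ 2) ^ (m + 1) / 4 : ℝ) ((m : ℝ) * 4 ^ N / 4) :=
  ⟨symbol_frdPiecePow_re_ge ψ hA hs h0 h4 hm N hle, symbol_frdPiecePow_re_le ψ hA hs h0 h4 m N⟩

end Bounds

end Literature.Analysis.Matrix

end
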